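import Mathlib
import HarnessLib
import Summits.Ventures.LatticeQCDFlow.Exactness.RefreshScan
import Summits.Ventures.LatticeQCDFlow.Exactness.IMHKernel

/-!
# LatticeQCDFlow / Exactness — LEARNING ON THE JOB, VIII: THE `N`-WALKER POPULATION FLOW SAMPLER — updating walker `i` from a flow fitted
# to the other walkers is exact for the product target, and so is every sweep over the walkers (the tree's `siteLift` vocabulary)

HONEST FRAMING: exact (Metropolis-corrected) sampling algorithms for lattice gauge theory;
figures of merit are autocorrelation/cost numbers at stated couplings and volumes; no
continuum-physics claim.

Venture `LatticeQCDFlow` (cell pub-lqcd), topic `Exactness`, FANOUT row 30 (lean-1 GEN-44, theme LEARNING ON THE JOB).  NEW WORK of the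
cell; no definition is introduced.  Tree inputs: `RefreshScan` (`siteLift i κ` — overwrite coordinate `i` with a draw from `κ ω`, which
may read the whole configuration; `lintegral_siteLift`), `InvariantComposition` (`cycle`, `invariant_cycle`), `IMHKernel`, Mathlib's
iterated marginals `∫⋯∫⁻`.  `PopulationLeaveOneOutExact` is the two-block form (walker ∕ rest); this file is the practitioner's form: `N`
walkers indexed by a finite `ι`, walker `i` living in `X i` with target `μ i`, population target `⊗_i μ_i`.

## Setting
`κ : Kernel (Π j, X j) (X i)` — the law of walker `i`'s next state given the whole population (its own current state included: a
Metropolis step from `ω_i` proposing from a flow fitted to `(ω_j)_{j ≠ i}`).  THE LEAVE-ONE-OUT HYPOTHESIS (`hκ`): with the other walkers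
frozen, the one-walker update is exact for `μ_i` — `∫ κ(ω|ω_i := x)(B) μ_i(dx) = μ_i(B)` for every `ω`.  The population move is the tree's
`siteLift i κ`.

## Results (no `sorry`)
* §1 `looSite_lintegral_section` — the hypothesis in integrated form.
* §2 **`looSite_invariant`** — `siteLift i κ` leaves `Measure.pi μ` invariant: ONE walker moved by a kernel fitted to the others is
  exact for the product (iterated marginals: integrate walker `i` first).  **`looSiteSweep_invariant`** — any CYCLE of such updates over any
  list of walkers (a systematic sweep, repeated visits, any order), each reading the CURRENT others, is exact (`invariant_cycle`).
* §3 THE FLOW INSTANCE (**`looSiteFlow_invariant`**, `looSiteFlow_sweep_invariant`): fitted flows `q : Kernel (Π j, X j) (X i)` and weights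
  `w ω` that read only the other walkers (`hκ` displays `q ω`, `w ω` unchanged along `ω|ω_i := x`), each paired with its own weight,
  `w(ω, ·)·q(ω) = μ_i`: walker `i`'s flow-Metropolis step and every sweep of such steps are exact for `⊗_i μ_i`.
NOT here: all walkers at once from flows fitted to each other's current states — biased (`PopulationSimultaneousBias`).
-/

noncomputable section

namespace Summit.Ventures.LatticeQCDFlow.Exactness

open MeasureTheory ProbabilityTheory Function
open scoped _root_.ENNReal

variable {ι : Type*} [DecidableEq ι] [Fintype ι] {X : ι → Type*} [∀ i, MeasurableSpace (X i)] {μ : Π i, Measure (X i)}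
  [∀ i, IsProbabilityMeasure (μ i)]

/-! ## §1 The leave-one-out hypothesis in integrated form -/

omit [Fintype ι] [∀ i, IsProbabilityMeasure (μ i)] in
/-- `∫ (∫ f dκ(ω|ω_i := x)) μ_i(dx) = ∫ f dμ_i` for measurable `f ≥ 0`. [ours, bookkeeping] -/
theorem looSite_lintegral_section (i : ι) (κ : Kernel (Π j, X j) (X i))
    (hκ : ∀ (ω : Π j, X j) {B : Set (X i)}, MeasurableSet B → ∫⁻ x, κ (update ω i x) B ∂(μ i) = μ i B) (ω : Π j, X j)
    {f : X i → ℝ≥0∞} (hf : Measurable f) : ∫⁻ x, ∫⁻ ξ, f ξ ∂(κ (update ω i x)) ∂(μ i) = ∫⁻ ξ, f ξ ∂(μ i) := by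
  have hsec : (μ i).bind (κ.comap (update ω i) (measurable_update ω)) = μ i := by
    ext B hB
    rw [Measure.bind_apply hB (Kernel.aemeasurable _)]
    simp_rw [Kernel.comap_apply]
    exact hκ ω hB
  have hb := Measure.lintegral_bind (m := μ i) (Kernel.aemeasurable (κ.comap (update ω i) (measurable_update ω))) (f := f)
    hf.aemeasurable
  rw [hsec] at hb
  simp_rw [Kernel.comap_apply] at hb
  exact hb.symm

/-! ## §2 One walker from the others: exact for the product; sweeps -/

/-- **THE LEAVE-ONE-OUT SITE UPDATE IS EXACT FOR THE PRODUCT**: `siteLift i κ` leaves `⊗_j μ_j` invariant whenever every frozen-others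
section of `κ` is exact for `μ_i`. [ours] -/
theorem looSite_invariant (i : ι) (κ : Kernel (Π j, X j) (X i)) [IsMarkovKernel κ]
    (hκ : ∀ (ω : Π j, X j) {B : Set (X i)}, MeasurableSet B → ∫⁻ x, κ (update ω i x) B ∂(μ i) = μ i B) :
    Kernel.Invariant (siteLift i κ) (Measure.pi μ) := by
  have hne : ∀ j, Nonempty (X j) := fun j => nonempty_of_isProbabilityMeasure (μ j)
  let z : Π j, X j := fun j => Classical.choice (hne j)
  show (Measure.pi μ).bind (siteLift i κ) = Measure.pi μ
  ext s hs
  have hF : Measurable fun ω => siteLift i κ ω s := Kernel.measurable_coe _ hs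
  have h1s : Measurable (s.indicator (1 : (Π j, X j) → ℝ≥0∞)) := measurable_one.indicator hs
  rw [Measure.bind_apply hs (Kernel.aemeasurable _), lintegral_eq_lmarginal_univ z, lmarginal_erase' _ hF (Finset.mem_univ i)]
  -- integrating walker `i` first: the section hypothesis turns the update into the free marginal
  have hinner : (fun x : Π j, X j => ∫⁻ xᵢ, siteLift i κ (update x i xᵢ) s ∂μ i) =
      fun x => ∫⁻ xᵢ, s.indicator 1 (update x i xᵢ) ∂μ i := by
    funext x
    have h1 : ∀ xᵢ, siteLift i κ (update x i xᵢ) s = ∫⁻ ξ, s.indicator 1 (update x i ξ) ∂(κ (update x i xᵢ)) := fun xᵢ => by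
      rw [← lintegral_indicator_one hs, lintegral_siteLift _ _ _ h1s]
      simp_rw [update_idem]
    simp_rw [h1]
    exact looSite_lintegral_section i κ hκ x (h1s.comp (measurable_update x))
  rw [hinner, ← lmarginal_erase' _ h1s (Finset.mem_univ i), ← lintegral_eq_lmarginal_univ z, lintegral_indicator_one hs]

/-- **EVERY SWEEP OF LEAVE-ONE-OUT UPDATES IS EXACT**: for any list of walkers `l` and updates `κ i` each satisfying the hypothesis, the
cycle `siteLift i₁ (κ i₁) ∘ ⋯` leaves `⊗_j μ_j` invariant — each walker, at its turn, reads the CURRENT states of the others. [ours] -/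
theorem looSiteSweep_invariant (κ : Π i, Kernel (Π j, X j) (X i)) [∀ i, IsMarkovKernel (κ i)]
    (hκ : ∀ (i : ι) (ω : Π j, X j) {B : Set (X i)}, MeasurableSet B → ∫⁻ x, κ i (update ω i x) B ∂(μ i) = μ i B) (l : List ι) :
    Kernel.Invariant (cycle (l.map fun i => siteLift i (κ i))) (Measure.pi μ) := by
  refine invariant_cycle fun K hK => ?_
  obtain ⟨i, -, rfl⟩ := List.mem_map.1 hK
  exact looSite_invariant i (κ i) (hκ i)

/-! ## §3 The flow instance -/

/-- **WALKER `i` FROM A FLOW FITTED TO THE OTHERS IS EXACT**: flows `q ω` and positive weights `w ω` reading only the other walkers, paired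
so that `w(ω, ·)·q(ω) = μ_i`; any `κ` whose frozen-others sections are the flow sampler `indepMH (q ω) (w ω)` makes `siteLift i κ` exact for
`⊗_j μ_j`. [ours] -/
theorem looSiteFlow_invariant (i : ι) (q : Kernel (Π j, X j) (X i)) [IsMarkovKernel q] {w : (Π j, X j) → X i → ℝ}
    (hw : ∀ ω, Measurable (w ω)) (hw0 : ∀ ω y, 0 < w ω y) (hπ : ∀ ω, ((q ω).withDensity fun y => ENNReal.ofReal (w ω y)) = μ i)
    (κ : Kernel (Π j, X j) (X i)) [IsMarkovKernel κ]
    (hκ : ∀ (ω : Π j, X j) (x : X i) {B : Set (X i)}, MeasurableSet B → κ (update ω i x) B =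
      ∫⁻ y in B, imhAcceptE (w ω) x y ∂(q ω) + (1 - imhAcceptMass (q ω) (w ω) x) * B.indicator 1 x) :
    Kernel.Invariant (siteLift i κ) (Measure.pi μ) := by
  refine looSite_invariant i κ fun ω B hB => ?_
  have hsec : ∀ x, κ (update ω i x) B = indepMH (q ω) (w ω) x B := fun x => by
    rw [hκ ω x hB, indepMH_apply (hw ω) x hB]
  simp_rw [hsec]
  have hinv := (indepMH_invariant (q := q ω) (hw ω) (hw0 ω)).def
  rw [hπ ω] at hinv
  have := congrArg (fun m : Measure (X i) => m B) hinv
  simpa only [Measure.bind_apply hB (Kernel.aemeasurable _)] using this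

/-- **… AND EVERY SWEEP OF SUCH FLOW STEPS IS EXACT** (one fitted-flow family per walker). [ours] -/
theorem looSiteFlow_sweep_invariant (q : Π i, Kernel (Π j, X j) (X i)) [∀ i, IsMarkovKernel (q i)] {w : Π i, (Π j, X j) → X i → ℝ}
    (hw : ∀ i ω, Measurable (w i ω)) (hw0 : ∀ i ω y, 0 < w i ω y)
    (hπ : ∀ i ω, ((q i ω).withDensity fun y => ENNReal.ofReal (w i ω y)) = μ i) (κ : Π i, Kernel (Π j, X j) (X i))
    [∀ i, IsMarkovKernel (κ i)]
    (hκ : ∀ (i : ι) (ω : Π j, X j) (x : X i) {B : Set (X i)}, MeasurableSet B → κ i (update ω i x) B =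
      ∫⁻ y in B, imhAcceptE (w i ω) x y ∂(q i ω) + (1 - imhAcceptMass (q i ω) (w i ω) x) * B.indicator 1 x) (l : List ι) :
    Kernel.Invariant (cycle (l.map fun i => siteLift i (κ i))) (Measure.pi μ) := by
  refine invariant_cycle fun K hK => ?_
  obtain ⟨i, -, rfl⟩ := List.mem_map.1 hK
  exact looSiteFlow_invariant i (q i) (hw i) (hw0 i) (hπ i) (κ i) (hκ i)

end Summit.Ventures.LatticeQCDFlow.Exactness
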